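import Literature.MathematicalPhysics.QuantumFieldTheory.Balaban1983to89.B16Ineq17FlatRouteConstants
import Literature.MathematicalPhysics.QuantumFieldTheory.Balaban1983to89.B16Ineq19NearFlatSlice

/-!
# `Balaban1983to89.B16Ineq17SliceTwist` — the TWIST LETTER (T) of the near-flat one-sided (1.7) route: if two slice vectors `X, X̃ ∈ GaugeSlice S T ℝ³` are bond-wise
# `τ`-close RELATIVE TO `X` (`‖ιA X̃ b − ιA X b‖ ≤ τ‖ιA X b‖` — e.g. `X̃_b = R_b X_b` for per-bond linear maps with `‖R_b − 1‖ ≤ τ`, the `Ad_{W_k(b)⁻¹}`-twist of the datum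
# velocity at a bond-wise `τ∕2`-near-flat background, [Balaban1989LargeFieldII] p. 357), then the window circulation sums of the one-sided (1.7) letter `h17` differ by
# `O(τ)‖X‖²`: `circ(X̃) ≥ circ(X) − 16(d+1)τ·‖X‖²`

statement-level skeleton of published theorems with citation tags; proofs where landed; nothing here is a claim about
the Yang–Mills mass gap.

T. Bałaban, *Large field renormalization. II*, Commun. Math. Phys. **122** (1989) 355–392 [Balaban1989LargeFieldII], p. 357 («we represent it on the domain Z as exp iξA₀,
with A₀ satisfying the bound |A₀|, |∇A₀| < O(1)M⁶R_kε_k», «expand in A₀ up to first order»), (1.7)–(1.8) p. 358; T. Bałaban, *Propagators and renormalization transformations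
… I*, Commun. Math. Phys. **95** (1984) 17–40 [Balaban1984PropagatorsI], (1.4) p. 18 (the lattice curl).

Cell pub-ymgap, HUMAN RULING D-0062 ∕ D-0149, seat `pub-ymgap-dag-n12-w4` g2 (U2c lane; WORD (β) of the N12 lane owner dag-n12-c g17, 2026-08-28 04:00Z, and this seat's
LOCATED READING (R2), 04:10Z: the datum velocity of the left perturbation `exp(iB′)·V` read in the datum-relative chart `msChart` is the Ad-TWISTED slice vector, so the
Federbush fibre letter `hm` delivers `γ₀·circ(X̃)` and the knit returns to `h17`'s `circ(X)` through THIS letter, the loss absorbed into `Cerr`).  Key K1⁷ stmt-QuantumFields-20542,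
helper, count-neutral.  CONSUMED BY NAME: g0's `B16Ineq17FlatRouteConstants.circ_eq_sum_normSq_oc` ∕ `sum_box_castSite_le_sum_of_subset` (p591325), dag-n12-w2 g2's
`B16Ineq19NearFlatSlice.sum_norm_sq_ιA` (p595572), p22's `B6StairStokesTorus.oc`.

WHAT THIS FILE PROVES (THEOREMS ONLY — no `def`, no `sorry`; axioms standard).
§1 `norm_oc_le_sum_norm` (`‖oc A μ ν s‖ ≤` the four bond norms), `norm_oc_sub_le` (`‖oc B μ ν s − oc A μ ν s‖ ≤ τ·(four bond norms of A)` under the relative closeness),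
   `sum_site_sum_dir_stencil_le` (the stencil count: `Σ_y Σ_μ (four bond norms²) = 2(d+1)·Σ_b ‖A_b‖²`-type bound).
§2 ★ `sq_norm_add_ge` (`‖a + e‖² ≥ (1 − τ)‖a‖² − τ⁻¹‖e‖²` for `0 < τ`), ★★ `circ_twist_ge` — for `X, X̃ ∈ GaugeSlice S T ℝ³` with `‖ιA X̃ b − ιA X b‖ ≤ τ‖ιA X b‖` (`0 < τ ≤ 1`)
   and a non-wrapping window: `circ(X̃) ≥ (1 − τ)·circ(X) − 8(d+1)τ·‖X‖²`, ★ `circ_le_normSq` (`circ(X) ≤ 8(d+1)·‖X‖²`), ★★ `circ_twist_ge_sub` (`circ(X̃) ≥ circ(X) − 16(d+1)τ‖X‖²`).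

HONEST SCOPE.  Elementary slice algebra (triangle inequality, a stencil count); the relative closeness is a DISPLAYED hypothesis (its producer at the record: the bond-wise near-flat
gauge of the background, dag-n13-w2's (J-c) p595951, through `‖Ad_u Y − Y‖ ≤ 2‖u − 1‖‖Y‖`); nothing of Bałaban's asserted; count-neutral; N12 NOT discharged; K1⁷ NOT closed;
one finite 𝕋⁴ programme at fixed `ε`; R4 closes the conditional finite-𝕋⁴ rung `BalabanLadder.UV` only — the Yang–Mills mass gap (Clay) is NOT proved by any of this.
-/

noncomputable section

open Set Finset
open scoped BigOperators

namespace Literature.MathematicalPhysics.QuantumFieldTheory.Balaban1983to89.B16Ineq17SliceTwist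

open B15DeterminingSets GaugeField
open B15Prop1SliceCoordinates (GaugeSlice ιA)
open T4AxialGaugeSmallField (castSite)
open B6TreeGaugePoincare (curl)
open B16Eq18Proof (box)
open B6StairStokesTorus (oc)
open B16Ineq17FlatRouteConstants (circ_eq_sum_normSq_oc sum_box_castSite_le_sum_of_subset)
open B16Ineq19NearFlatSlice (sum_norm_sq_ιA)

variable {P : Params} {k : ℕ}

/-! ## §1  Bond-wise bookkeeping for the ordered plaquette variable `oc` -/

section Bookkeeping

variable {V : Type*} [NormedAddCommGroup V]

/-- `‖oc A μ ν s‖ ≤ ‖A⟨s,μ⟩‖ + ‖A⟨s+e_μ,ν⟩‖ + ‖A⟨s+e_ν,μ⟩‖ + ‖A⟨s,ν⟩‖`. [cite: Balaban1984PropagatorsI, (1.4) p.18 (bookkeeping)] -/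
theorem norm_oc_le_sum_norm (A : VecField P k V) (μ ν : Fin P.d) (s : Site P k) :
    ‖oc A μ ν s‖ ≤ ‖A ⟨s, μ⟩‖ + ‖A ⟨s.shift μ, ν⟩‖ + ‖A ⟨s.shift ν, μ⟩‖ + ‖A ⟨s, ν⟩‖ := by
  unfold oc
  calc ‖A ⟨s, μ⟩ + A ⟨s.shift μ, ν⟩ - A ⟨s.shift ν, μ⟩ - A ⟨s, ν⟩‖
      ≤ ‖A ⟨s, μ⟩ + A ⟨s.shift μ, ν⟩ - A ⟨s.shift ν, μ⟩‖ + ‖A ⟨s, ν⟩‖ := norm_sub_le _ _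
    _ ≤ (‖A ⟨s, μ⟩ + A ⟨s.shift μ, ν⟩‖ + ‖A ⟨s.shift ν, μ⟩‖) + ‖A ⟨s, ν⟩‖ := by
        have := norm_sub_le (A ⟨s, μ⟩ + A ⟨s.shift μ, ν⟩) (A ⟨s.shift ν, μ⟩); linarith
    _ ≤ (‖A ⟨s, μ⟩‖ + ‖A ⟨s.shift μ, ν⟩‖ + ‖A ⟨s.shift ν, μ⟩‖) + ‖A ⟨s, ν⟩‖ := by
        have := norm_add_le (A ⟨s, μ⟩) (A ⟨s.shift μ, ν⟩); linarith

/-- **THE TWIST MOVES EACH PLAQUETTE VARIABLE BY `τ·(bond norms)`**: if `‖B b − A b‖ ≤ τ‖A b‖` on every bond then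
`‖oc B μ ν s − oc A μ ν s‖ ≤ τ·(‖A⟨s,μ⟩‖ + ‖A⟨s+e_μ,ν⟩‖ + ‖A⟨s+e_ν,μ⟩‖ + ‖A⟨s,ν⟩‖)` (`oc` is additive). [cite: Balaban1989LargeFieldII, p.357; Balaban1984PropagatorsI, (1.4) p.18] -/
theorem norm_oc_sub_le (A B : VecField P k V) {τ : ℝ} (hAB : ∀ b, ‖B b - A b‖ ≤ τ * ‖A b‖) (μ ν : Fin P.d) (s : Site P k) :
    ‖oc B μ ν s - oc A μ ν s‖ ≤ τ * (‖A ⟨s, μ⟩‖ + ‖A ⟨s.shift μ, ν⟩‖ + ‖A ⟨s.shift ν, μ⟩‖ + ‖A ⟨s, ν⟩‖) := by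
  have hsub : oc B μ ν s - oc A μ ν s = oc (B - A) μ ν s := by
    simp only [oc, Pi.sub_apply]
    abel
  rw [hsub]
  refine (norm_oc_le_sum_norm (B - A) μ ν s).trans ?_
  simp only [Pi.sub_apply]
  have h1 := hAB ⟨s, μ⟩; have h2 := hAB ⟨s.shift μ, ν⟩; have h3 := hAB ⟨s.shift ν, μ⟩; have h4 := hAB ⟨s, ν⟩
  linarith

omit [NormedAddCommGroup V] in
/-- `(a + b + c + d)² ≤ 4(a² + b² + c² + d²)` (private copy; the tree's `Literature.NumberTheory.Sieve.MatomakiRadziwillThm3.sq_add_four_le` is the same sentence in an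
unrelated import chain). [folklore] -/
private theorem sum_sq_four_le (a b c d : ℝ) : (a + b + c + d) ^ 2 ≤ 4 * (a ^ 2 + b ^ 2 + c ^ 2 + d ^ 2) := by
  nlinarith [sq_nonneg (a - b), sq_nonneg (a - c), sq_nonneg (a - d), sq_nonneg (b - c), sq_nonneg (b - d), sq_nonneg (c - d)]

/-- A sum over bonds is a double sum over sources and directions. [cite: Balaban1985Averaging, (5) p.18 (bookkeeping)] -/
private theorem sum_pbond' {M : Type*} [AddCommMonoid M] (F : PBond P k → M) :
    ∑ b : PBond P k, F b = ∑ x : Site P k, ∑ μ : Fin P.d, F ⟨x, μ⟩ := by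
  rw [← Fintype.sum_prod_type (f := fun p : Site P k × Fin P.d => F ⟨p.1, p.2⟩)]
  exact Fintype.sum_equiv ⟨fun b => (b.src, b.dir), fun p => ⟨p.1, p.2⟩, fun _ => rfl, fun _ => rfl⟩ _ _ (fun _ => rfl)

/-- Translation invariance of a full site sum. [cite: Balaban1985Averaging, (5) p.18 (bookkeeping)] -/
private theorem sum_site_shift' {M : Type*} [AddCommMonoid M] (μ : Fin P.d) (f : Site P k → M) :
    ∑ x : Site P k, f (x.shift μ) = ∑ x : Site P k, f x :=
  Equiv.sum_comp (⟨fun x => x.shift μ, fun x => x.unshift μ, fun x => Site.unshift_shift x μ, fun x => Site.shift_unshift x μ⟩ :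
    Site P k ≃ Site P k) f

/-- **THE STENCIL COUNT**: summed over ALL sites `y` and all directions `ν`, the four squared bond norms of the `(e_μ, e_ν)`-stencil at `y` (fixed first direction `μ`)
total `2d·N_μ + 2·Σ_b ‖A_b‖² ≤ 2(d+1)·Σ_b ‖A_b‖²`, `N_μ = Σ_y ‖A⟨y,μ⟩‖²` (each of the four positions is a translate of a full bond sum).
[cite: Balaban1989LargeFieldII, (1.7) p.358 (bookkeeping); Balaban1985Averaging, (5) p.18] -/
theorem sum_site_sum_dir_stencil_le (A : VecField P k V) (μ : Fin P.d) :
    ∑ y : Site P k, ∑ ν : Fin P.d, (‖A ⟨y, μ⟩‖ ^ 2 + ‖A ⟨y.shift μ, ν⟩‖ ^ 2 + ‖A ⟨y.shift ν, μ⟩‖ ^ 2 + ‖A ⟨y, ν⟩‖ ^ 2)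
      ≤ 2 * ((P.d : ℝ) + 1) * ∑ b : PBond P k, ‖A b‖ ^ 2 := by
  have hNμ : ∑ y : Site P k, ‖A ⟨y, μ⟩‖ ^ 2 ≤ ∑ b : PBond P k, ‖A b‖ ^ 2 := by
    rw [sum_pbond' (fun b => ‖A b‖ ^ 2)]
    exact Finset.sum_le_sum fun y _ => Finset.single_le_sum (f := fun ν : Fin P.d => ‖A ⟨y, ν⟩‖ ^ 2) (fun _ _ => by positivity) (Finset.mem_univ μ)
  have h1 : ∑ y : Site P k, ∑ ν : Fin P.d, ‖A ⟨y, μ⟩‖ ^ 2 = (P.d : ℝ) * ∑ y : Site P k, ‖A ⟨y, μ⟩‖ ^ 2 := by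
    rw [Finset.mul_sum]
    refine Finset.sum_congr rfl fun y _ => ?_
    rw [Finset.sum_const, Finset.card_univ, Fintype.card_fin, nsmul_eq_mul]
  have h2 : ∑ y : Site P k, ∑ ν : Fin P.d, ‖A ⟨y.shift μ, ν⟩‖ ^ 2 = ∑ b : PBond P k, ‖A b‖ ^ 2 := by
    rw [sum_site_shift' μ (fun x => ∑ ν : Fin P.d, ‖A ⟨x, ν⟩‖ ^ 2), ← sum_pbond' (fun b => ‖A b‖ ^ 2)]
  have h3 : ∑ y : Site P k, ∑ ν : Fin P.d, ‖A ⟨y.shift ν, μ⟩‖ ^ 2 = (P.d : ℝ) * ∑ y : Site P k, ‖A ⟨y, μ⟩‖ ^ 2 := by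
    rw [Finset.sum_comm]
    have : ∀ ν : Fin P.d, ∑ y : Site P k, ‖A ⟨y.shift ν, μ⟩‖ ^ 2 = ∑ y : Site P k, ‖A ⟨y, μ⟩‖ ^ 2 := fun ν =>
      sum_site_shift' ν (fun x => ‖A ⟨x, μ⟩‖ ^ 2)
    simp only [this, Finset.sum_const, Finset.card_univ, Fintype.card_fin, nsmul_eq_mul]
  have h4 : ∑ y : Site P k, ∑ ν : Fin P.d, ‖A ⟨y, ν⟩‖ ^ 2 = ∑ b : PBond P k, ‖A b‖ ^ 2 := (sum_pbond' (fun b => ‖A b‖ ^ 2)).symm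
  have hsplit : ∑ y : Site P k, ∑ ν : Fin P.d, (‖A ⟨y, μ⟩‖ ^ 2 + ‖A ⟨y.shift μ, ν⟩‖ ^ 2 + ‖A ⟨y.shift ν, μ⟩‖ ^ 2 + ‖A ⟨y, ν⟩‖ ^ 2)
      = ∑ y : Site P k, ∑ ν : Fin P.d, ‖A ⟨y, μ⟩‖ ^ 2 + ∑ y : Site P k, ∑ ν : Fin P.d, ‖A ⟨y.shift μ, ν⟩‖ ^ 2
        + ∑ y : Site P k, ∑ ν : Fin P.d, ‖A ⟨y.shift ν, μ⟩‖ ^ 2 + ∑ y : Site P k, ∑ ν : Fin P.d, ‖A ⟨y, ν⟩‖ ^ 2 := by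
    simp only [Finset.sum_add_distrib]
  rw [hsplit, h1, h2, h3, h4]
  have hd : (0 : ℝ) ≤ P.d := Nat.cast_nonneg _
  have hB : 0 ≤ ∑ b : PBond P k, ‖A b‖ ^ 2 := Finset.sum_nonneg fun b _ => by positivity
  have hN0 : 0 ≤ ∑ y : Site P k, ‖A ⟨y, μ⟩‖ ^ 2 := Finset.sum_nonneg fun y _ => by positivity
  nlinarith [hNμ, hd, hB, hN0, mul_le_mul_of_nonneg_left hNμ hd]

end Bookkeeping

/-! ## §2  The twist letter for the window circulation sum -/

section Twist

/-- ★ **`‖a + e‖² ≥ (1 − τ)‖a‖² − τ⁻¹‖e‖²`** for `0 < τ` (from `2‖a‖‖e‖ ≤ τ‖a‖² + τ⁻¹‖e‖²`). [cite: Balaban1989LargeFieldII, (1.7) p.358 (bookkeeping)] -/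
theorem sq_norm_add_ge {V : Type*} [NormedAddCommGroup V] (a e : V) {τ : ℝ} (hτ : 0 < τ) :
    (1 - τ) * ‖a‖ ^ 2 - τ⁻¹ * ‖e‖ ^ 2 ≤ ‖a + e‖ ^ 2 := by
  have h1 : ‖a‖ - ‖e‖ ≤ ‖a + e‖ := by
    have := norm_sub_le (a + e) e
    rw [add_sub_cancel_right] at this
    linarith
  -- AM–GM with weight `τ`: `2‖a‖‖e‖ ≤ τ‖a‖² + τ⁻¹‖e‖²`
  have ham : 2 * ‖a‖ * ‖e‖ ≤ τ * ‖a‖ ^ 2 + τ⁻¹ * ‖e‖ ^ 2 := by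
    have hτ0 : τ ≠ 0 := hτ.ne'
    have hsq : 0 ≤ (τ * ‖a‖ - ‖e‖) ^ 2 := sq_nonneg _
    have hmul : τ * (2 * ‖a‖ * ‖e‖) ≤ τ * (τ * ‖a‖ ^ 2 + τ⁻¹ * ‖e‖ ^ 2) := by
      have hR : τ * (τ * ‖a‖ ^ 2 + τ⁻¹ * ‖e‖ ^ 2) = τ ^ 2 * ‖a‖ ^ 2 + ‖e‖ ^ 2 := by
        field_simp
      rw [hR]
      nlinarith [hsq]
    exact le_of_mul_le_mul_left hmul hτ
  have ha0 : 0 ≤ ‖a‖ := norm_nonneg a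
  have he0 : 0 ≤ ‖e‖ := norm_nonneg e
  by_cases hae : ‖e‖ ≤ ‖a‖
  · have h2 : (‖a‖ - ‖e‖) ^ 2 ≤ ‖a + e‖ ^ 2 := pow_le_pow_left₀ (by linarith) h1 2
    calc (1 - τ) * ‖a‖ ^ 2 - τ⁻¹ * ‖e‖ ^ 2 ≤ ‖a‖ ^ 2 - 2 * ‖a‖ * ‖e‖ := by linarith [ham]
      _ ≤ ‖a‖ ^ 2 - 2 * ‖a‖ * ‖e‖ + ‖e‖ ^ 2 := by nlinarith [he0]
      _ = (‖a‖ - ‖e‖) ^ 2 := by ring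
      _ ≤ ‖a + e‖ ^ 2 := h2
  · have hae' : ‖a‖ < ‖e‖ := lt_of_not_ge hae
    calc (1 - τ) * ‖a‖ ^ 2 - τ⁻¹ * ‖e‖ ^ 2 ≤ ‖a‖ ^ 2 - 2 * ‖a‖ * ‖e‖ := by linarith [ham]
      _ ≤ 0 := by nlinarith [hae', ha0]
      _ ≤ ‖a + e‖ ^ 2 := sq_nonneg _

variable [DecidableEq (PBond P k)]

/-- ★★ **THE TWIST LETTER (T)**: for slice vectors `X, X̃` whose bond fields are RELATIVELY `τ`-close (`‖ιA X̃ b − ιA X b‖ ≤ τ‖ιA X b‖`, `0 < τ`) and a non-wrapping window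
`box m lo` (`m_κ ≤ sitesPerDir k`), the window circulation sums of the one-sided (1.7) letter satisfy `circ(X̃) ≥ (1 − τ)·circ(X) − 8(d+1)τ·‖X‖²` (per window
term `‖oc(ιA X̃)‖² ≥ (1−τ)‖oc(ιA X)‖² − τ⁻¹‖oc(ιA X̃) − oc(ιA X)‖²`, the last `≤ 4τ²·(stencil norms²)`, and the stencil count `≤ 2(d+1)‖X‖²`). [cite: Balaban1989LargeFieldII, p.357, (1.7)–(1.8) p.358; Balaban1984PropagatorsI, (1.4) p.18] -/
theorem circ_twist_ge (h0 : 0 < P.d) {S : Set (Site P k)} {T : Finset (PBond P k)} (X X' : GaugeSlice S T (EuclideanSpace ℝ (Fin 3)))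
    {τ : ℝ} (hτ : 0 < τ) (hAB : ∀ b, ‖ιA S T X' b - ιA S T X b‖ ≤ τ * ‖ιA S T X b‖)
    {m : Fin P.d → ℕ} (lo : Fin P.d → ℤ) (hm : ∀ κ, (m κ : ℤ) ≤ P.sitesPerDir k) :
    (1 - τ) * (∑ z ∈ box m lo, ∑ μ : Fin P.d, ∑ a : Fin 3, curl (fun b => ιA S T X (⟨castSite b.1, b.2⟩ : PBond P k) a) z ⟨0, h0⟩ μ ^ 2)
        - 8 * ((P.d : ℝ) + 1) * τ * ‖X‖ ^ 2
      ≤ ∑ z ∈ box m lo, ∑ μ : Fin P.d, ∑ a : Fin 3, curl (fun b => ιA S T X' (⟨castSite b.1, b.2⟩ : PBond P k) a) z ⟨0, h0⟩ μ ^ 2 := by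
  rw [circ_eq_sum_normSq_oc h0 X (box m lo), circ_eq_sum_normSq_oc h0 X' (box m lo)]
  set A := ιA S T X with hA
  set B := ιA S T X' with hB
  -- per (z, μ): `‖oc B‖² ≥ (1−τ)‖oc A‖² − τ⁻¹‖oc B − oc A‖²` and `‖oc B − oc A‖² ≤ τ²·4·(stencil norms²)`
  have hterm : ∀ (z : Fin P.d → ℤ) (μ : Fin P.d),
      (1 - τ) * ‖oc A ⟨0, h0⟩ μ (castSite z)‖ ^ 2
          - τ * (4 * (‖A ⟨castSite z, ⟨0, h0⟩⟩‖ ^ 2 + ‖A ⟨(castSite z : Site P k).shift ⟨0, h0⟩, μ⟩‖ ^ 2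
              + ‖A ⟨(castSite z : Site P k).shift μ, ⟨0, h0⟩⟩‖ ^ 2 + ‖A ⟨castSite z, μ⟩‖ ^ 2))
        ≤ ‖oc B ⟨0, h0⟩ μ (castSite z)‖ ^ 2 := by
    intro z μ
    have hsq := sq_norm_add_ge (oc A ⟨0, h0⟩ μ (castSite z)) (oc B ⟨0, h0⟩ μ (castSite z) - oc A ⟨0, h0⟩ μ (castSite z)) hτ
    rw [add_sub_cancel] at hsq
    have he := norm_oc_sub_le A B hAB ⟨0, h0⟩ μ (castSite z)
    have he0 : 0 ≤ ‖oc B ⟨0, h0⟩ μ (castSite z) - oc A ⟨0, h0⟩ μ (castSite z)‖ := norm_nonneg _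
    have he2 : ‖oc B ⟨0, h0⟩ μ (castSite z) - oc A ⟨0, h0⟩ μ (castSite z)‖ ^ 2
        ≤ τ ^ 2 * (4 * (‖A ⟨castSite z, ⟨0, h0⟩⟩‖ ^ 2 + ‖A ⟨(castSite z : Site P k).shift ⟨0, h0⟩, μ⟩‖ ^ 2
              + ‖A ⟨(castSite z : Site P k).shift μ, ⟨0, h0⟩⟩‖ ^ 2 + ‖A ⟨castSite z, μ⟩‖ ^ 2)) := by
      have h1 : ‖oc B ⟨0, h0⟩ μ (castSite z) - oc A ⟨0, h0⟩ μ (castSite z)‖ ^ 2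
          ≤ (τ * (‖A ⟨castSite z, ⟨0, h0⟩⟩‖ + ‖A ⟨(castSite z : Site P k).shift ⟨0, h0⟩, μ⟩‖ + ‖A ⟨(castSite z : Site P k).shift μ, ⟨0, h0⟩⟩‖
              + ‖A ⟨castSite z, μ⟩‖)) ^ 2 := pow_le_pow_left₀ he0 he 2
      have h2 := sum_sq_four_le ‖A ⟨castSite z, ⟨0, h0⟩⟩‖ ‖A ⟨(castSite z : Site P k).shift ⟨0, h0⟩, μ⟩‖ ‖A ⟨(castSite z : Site P k).shift μ, ⟨0, h0⟩⟩‖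
        ‖A ⟨castSite z, μ⟩‖
      have hτ2 : 0 ≤ τ ^ 2 := sq_nonneg τ
      calc _ ≤ _ := h1
        _ = τ ^ 2 * (‖A ⟨castSite z, ⟨0, h0⟩⟩‖ + ‖A ⟨(castSite z : Site P k).shift ⟨0, h0⟩, μ⟩‖ + ‖A ⟨(castSite z : Site P k).shift μ, ⟨0, h0⟩⟩‖
              + ‖A ⟨castSite z, μ⟩‖) ^ 2 := by ring
        _ ≤ _ := mul_le_mul_of_nonneg_left h2 hτ2
    have hτinv : τ⁻¹ * (τ ^ 2 * (4 * (‖A ⟨castSite z, ⟨0, h0⟩⟩‖ ^ 2 + ‖A ⟨(castSite z : Site P k).shift ⟨0, h0⟩, μ⟩‖ ^ 2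
              + ‖A ⟨(castSite z : Site P k).shift μ, ⟨0, h0⟩⟩‖ ^ 2 + ‖A ⟨castSite z, μ⟩‖ ^ 2)))
        = τ * (4 * (‖A ⟨castSite z, ⟨0, h0⟩⟩‖ ^ 2 + ‖A ⟨(castSite z : Site P k).shift ⟨0, h0⟩, μ⟩‖ ^ 2
              + ‖A ⟨(castSite z : Site P k).shift μ, ⟨0, h0⟩⟩‖ ^ 2 + ‖A ⟨castSite z, μ⟩‖ ^ 2)) := by
      rw [← mul_assoc, show τ⁻¹ * τ ^ 2 = τ by rw [pow_two, ← mul_assoc, inv_mul_cancel₀ hτ.ne', one_mul]]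
    have h3 := mul_le_mul_of_nonneg_left he2 (inv_nonneg.mpr hτ.le)
    rw [hτinv] at h3
    linarith
  -- sum over the window and bound the stencil sum by the full-torus stencil count
  have hsum := Finset.sum_le_sum fun z (hz : z ∈ box m lo) => Finset.sum_le_sum fun μ (_ : μ ∈ (Finset.univ : Finset (Fin P.d))) => hterm z μ
  have hst : ∑ z ∈ box m lo, ∑ μ : Fin P.d, (4 * (‖A ⟨castSite z, ⟨0, h0⟩⟩‖ ^ 2 + ‖A ⟨(castSite z : Site P k).shift ⟨0, h0⟩, μ⟩‖ ^ 2
              + ‖A ⟨(castSite z : Site P k).shift μ, ⟨0, h0⟩⟩‖ ^ 2 + ‖A ⟨castSite z, μ⟩‖ ^ 2))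
      ≤ 8 * ((P.d : ℝ) + 1) * ‖X‖ ^ 2 := by
    have hwin := sum_box_castSite_le_sum_of_subset lo hm (Finset.univ : Finset (Site P k)) (fun _ _ => Finset.mem_univ _)
      (fun y => ∑ μ : Fin P.d, (4 * (‖A ⟨y, ⟨0, h0⟩⟩‖ ^ 2 + ‖A ⟨y.shift ⟨0, h0⟩, μ⟩‖ ^ 2 + ‖A ⟨y.shift μ, ⟨0, h0⟩⟩‖ ^ 2 + ‖A ⟨y, μ⟩‖ ^ 2)))
      (fun y => Finset.sum_nonneg fun μ _ => by positivity)
    have hcount := sum_site_sum_dir_stencil_le A ⟨0, h0⟩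
    rw [sum_norm_sq_ιA] at hcount
    have h4 : ∑ y : Site P k, ∑ μ : Fin P.d, (4 * (‖A ⟨y, ⟨0, h0⟩⟩‖ ^ 2 + ‖A ⟨y.shift ⟨0, h0⟩, μ⟩‖ ^ 2 + ‖A ⟨y.shift μ, ⟨0, h0⟩⟩‖ ^ 2 + ‖A ⟨y, μ⟩‖ ^ 2))
        = 4 * ∑ y : Site P k, ∑ μ : Fin P.d, (‖A ⟨y, ⟨0, h0⟩⟩‖ ^ 2 + ‖A ⟨y.shift ⟨0, h0⟩, μ⟩‖ ^ 2 + ‖A ⟨y.shift μ, ⟨0, h0⟩⟩‖ ^ 2 + ‖A ⟨y, μ⟩‖ ^ 2) := by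
      rw [Finset.mul_sum]
      refine Finset.sum_congr rfl fun y _ => ?_
      rw [Finset.mul_sum]
    linarith
  have hτst := mul_le_mul_of_nonneg_left hst hτ.le
  -- assemble
  have hL : (1 - τ) * ∑ z ∈ box m lo, ∑ μ : Fin P.d, ‖oc A ⟨0, h0⟩ μ (castSite z)‖ ^ 2
      - τ * ∑ z ∈ box m lo, ∑ μ : Fin P.d, (4 * (‖A ⟨castSite z, ⟨0, h0⟩⟩‖ ^ 2 + ‖A ⟨(castSite z : Site P k).shift ⟨0, h0⟩, μ⟩‖ ^ 2
              + ‖A ⟨(castSite z : Site P k).shift μ, ⟨0, h0⟩⟩‖ ^ 2 + ‖A ⟨castSite z, μ⟩‖ ^ 2))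
      = ∑ z ∈ box m lo, ∑ μ : Fin P.d, ((1 - τ) * ‖oc A ⟨0, h0⟩ μ (castSite z)‖ ^ 2
          - τ * (4 * (‖A ⟨castSite z, ⟨0, h0⟩⟩‖ ^ 2 + ‖A ⟨(castSite z : Site P k).shift ⟨0, h0⟩, μ⟩‖ ^ 2
              + ‖A ⟨(castSite z : Site P k).shift μ, ⟨0, h0⟩⟩‖ ^ 2 + ‖A ⟨castSite z, μ⟩‖ ^ 2))) := by
    simp only [Finset.mul_sum, Finset.sum_sub_distrib]
  linarith [hL, hsum, hτst]

/-- ★ **THE CIRCULATION SUM IS BOUNDED BY THE SLICE NORM**: `circ(X) ≤ 8(d+1)·‖X‖²` for a non-wrapping window. [cite: Balaban1989LargeFieldII, (1.7)–(1.8) p.358 (bookkeeping)] -/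
theorem circ_le_normSq (h0 : 0 < P.d) {S : Set (Site P k)} {T : Finset (PBond P k)} (X : GaugeSlice S T (EuclideanSpace ℝ (Fin 3)))
    {m : Fin P.d → ℕ} (lo : Fin P.d → ℤ) (hm : ∀ κ, (m κ : ℤ) ≤ P.sitesPerDir k) :
    ∑ z ∈ box m lo, ∑ μ : Fin P.d, ∑ a : Fin 3, curl (fun b => ιA S T X (⟨castSite b.1, b.2⟩ : PBond P k) a) z ⟨0, h0⟩ μ ^ 2
      ≤ 8 * ((P.d : ℝ) + 1) * ‖X‖ ^ 2 := by
  rw [circ_eq_sum_normSq_oc h0 X (box m lo)]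
  set A := ιA S T X with hA
  have hpt : ∀ (y : Site P k) (μ : Fin P.d), ‖oc A ⟨0, h0⟩ μ y‖ ^ 2
      ≤ 4 * (‖A ⟨y, ⟨0, h0⟩⟩‖ ^ 2 + ‖A ⟨y.shift ⟨0, h0⟩, μ⟩‖ ^ 2 + ‖A ⟨y.shift μ, ⟨0, h0⟩⟩‖ ^ 2 + ‖A ⟨y, μ⟩‖ ^ 2) := fun y μ =>
    (pow_le_pow_left₀ (norm_nonneg _) (norm_oc_le_sum_norm A ⟨0, h0⟩ μ y) 2).trans (sum_sq_four_le _ _ _ _)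
  have hwin := sum_box_castSite_le_sum_of_subset lo hm (Finset.univ : Finset (Site P k)) (fun _ _ => Finset.mem_univ _)
    (fun y => ∑ μ : Fin P.d, ‖oc A ⟨0, h0⟩ μ y‖ ^ 2) (fun y => Finset.sum_nonneg fun μ _ => by positivity)
  have hall : ∑ y : Site P k, ∑ μ : Fin P.d, ‖oc A ⟨0, h0⟩ μ y‖ ^ 2
      ≤ 4 * ∑ y : Site P k, ∑ μ : Fin P.d, (‖A ⟨y, ⟨0, h0⟩⟩‖ ^ 2 + ‖A ⟨y.shift ⟨0, h0⟩, μ⟩‖ ^ 2 + ‖A ⟨y.shift μ, ⟨0, h0⟩⟩‖ ^ 2 + ‖A ⟨y, μ⟩‖ ^ 2) := by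
    rw [Finset.mul_sum]
    refine Finset.sum_le_sum fun y _ => ?_
    rw [Finset.mul_sum]
    exact Finset.sum_le_sum fun μ _ => hpt y μ
  have hcount := sum_site_sum_dir_stencil_le A ⟨0, h0⟩
  rw [sum_norm_sq_ιA] at hcount
  linarith

/-- ★★ **THE TWIST LETTER IN THE SHAPE `Cerr` ABSORBS**: `circ(X̃) ≥ circ(X) − 16(d+1)τ·‖X‖²` for relatively `τ`-close slice vectors, `0 < τ`.
[cite: Balaban1989LargeFieldII, p.357, (1.7) p.358] -/
theorem circ_twist_ge_sub (h0 : 0 < P.d) {S : Set (Site P k)} {T : Finset (PBond P k)} (X X' : GaugeSlice S T (EuclideanSpace ℝ (Fin 3)))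
    {τ : ℝ} (hτ : 0 < τ) (hAB : ∀ b, ‖ιA S T X' b - ιA S T X b‖ ≤ τ * ‖ιA S T X b‖)
    {m : Fin P.d → ℕ} (lo : Fin P.d → ℤ) (hm : ∀ κ, (m κ : ℤ) ≤ P.sitesPerDir k) :
    (∑ z ∈ box m lo, ∑ μ : Fin P.d, ∑ a : Fin 3, curl (fun b => ιA S T X (⟨castSite b.1, b.2⟩ : PBond P k) a) z ⟨0, h0⟩ μ ^ 2)
        - 16 * ((P.d : ℝ) + 1) * τ * ‖X‖ ^ 2
      ≤ ∑ z ∈ box m lo, ∑ μ : Fin P.d, ∑ a : Fin 3, curl (fun b => ιA S T X' (⟨castSite b.1, b.2⟩ : PBond P k) a) z ⟨0, h0⟩ μ ^ 2 := by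
  have h1 := circ_twist_ge h0 X X' hτ hAB lo hm
  have h2 := circ_le_normSq h0 X lo hm
  have h3 : τ * (∑ z ∈ box m lo, ∑ μ : Fin P.d, ∑ a : Fin 3, curl (fun b => ιA S T X (⟨castSite b.1, b.2⟩ : PBond P k) a) z ⟨0, h0⟩ μ ^ 2)
      ≤ τ * (8 * ((P.d : ℝ) + 1) * ‖X‖ ^ 2) := mul_le_mul_of_nonneg_left h2 hτ.le
  nlinarith [h1, h3]

end Twist

end Literature.MathematicalPhysics.QuantumFieldTheory.Balaban1983to89.B16Ineq17SliceTwist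

end
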